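import Literature.Computability.Cryptography.ZhandryOracle
import Literature.Computability.Cryptography.OracleGames
import Literature.Computability.Complexity.OracleCompositionUniform
import Literature.Computability.Complexity.FPStringBricks
import Literature.Computability.Complexity.FinitePatching
import Literature.Computability.Complexity.StringEquality
import Literature.Computability.Complexity.LengthCompare
import Literature.Computability.Complexity.StockmeyerMachines
import Literature.Computability.Complexity.CHCounting
import HarnessLib

/-!
# The classical simulator behind Aaronson–Chen 2017, Thm. 7.6: answering the queries of a `BPP` machine to the oracle `specLang E T n j f` with oracle access to `f`

Topic `Literature/Computability/Cryptography`, toolkit below the named fact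
`Literature.Computability.Cryptography.aaronsonChen2017_thm76_bppMachine` of `ZhandryOracle.lean`
("let `M` be a `BPP` machine": a `BPP^O` machine probed at `1ⁿ` against the oracle of shape
`specLang E T n j f` IS a probabilistic polynomial-time oracle adversary against `f`), whose
proof (`ZhandryOracleProofs.lean`) composes the machine `M` with the polynomial-time
NON-ADAPTIVE oracle transducer `simN q B E T` of this file (Ladner–Lynch–Selman 1975, §3:
`ttFnAlg` of `TruthTableFunctions.lean`), which decides membership of a query `s` of `M` in

  `{s | s ∈ specLang E T n j f ∧ |s| ≤ q |z|}`    (`z = ⟨1ⁿ, r⟩` the input of `M`)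

given `u = ⟨z, s⟩` and oracle access to `f` on `{0,1}^j` (`oracleOfFnAt j f`, which answers
queries of any other length by `ε`), for every `1 ≤ j ≤ B n` and every length-preserving `f`:

* a value string `s = qryStr n x i` of the level under test: ask `x` (all `B |u|` queries); the
  concatenated answers are `(f x)^{B|u|}` if `|x| = j` and `ε` otherwise, so
  `s ∈ levelStrings n j f ↔ answers ≠ ε ∧ i < |x| ∧ (answers)ᵢ = 1`;
* an announcement string `s = ancStr n i`: ask `1^{i+1}, 1^{i+2}, …, 1^{i+B|u|}`; the
  concatenated answers are `f(1ʲ)` if `i < j` (exactly one probe has the length `j ≤ B n ≤ B |u|`)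
  and `ε` otherwise, so `s ∈ levelStrings n j f ↔ i < j ↔ answers ≠ ε`;
* any other `s`: membership in the finite hard-wired part `T` and in the filler blocks
  `levelStrings m m id`, `m ∉ E`, `m ≠ n`, is decided without the oracle (dummy queries `ε`).

Contents: the parse of level strings (`IsLevel`, `IsAnc`, `IsQry`, `lvl`, `ancIdx`, `pt`,
`qryIdx`; `mem_levelStrings_iff_parse`), the accessor maps and test languages (all in `FP` / `P`
by the closure toolkit of `Complexity/`: `pairFn`, `condFn`, `LenLe/LenLt/LenEq`, `NoBit`,
`bitAtFn`, finite patching), the query generator `simQ`, the evaluator language `simLang` and its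
indicator `simG`, the simulator `simN = ttFnAlg simQ B simG` (`isPolyTime_simN`), the
intermediate oracle `midOracle q E T n j f` it computes (`run_simN`), and the query-length bound
`length_le_of_mem_queries_simN`.

## References

* S. Aaronson, L. Chen, *Complexity-theoretic foundations of quantum supremacy experiments*,
  CCC 2017 (arXiv:1612.05903), proof of Thm. 7.6 (p. 30: "The oracle `O` will encode the truth
  tables of functions `f₁, f₂, …` … So let `M` be a `BPP` machine") [AaronsonChen2017].
* R. E. Ladner, N. A. Lynch, A. L. Selman, Theoret. Comput. Sci. 1 (1975), §3 (truth-table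
  oracle machines) [LadnerLynchSelman1975].
* S. Arora, B. Barak, *Computational Complexity: A Modern Approach*, CUP 2009, §3.4 (oracle
  machines), §1.3 (closure properties of polynomial time) [AroraBarak2009].
-/

namespace Literature.Computability.Cryptography

open _root_.Computability Complexity Complexity.OracleCompose Complexity.TTClosure Complexity.PRelSigma
  Complexity.StockMachine Polynomial

namespace ZhandrySim

/-! ### Small list lemmas -/

/-- A Boolean string without `0` is a block of ones. [folklore] -/
theorem eq_replicate_of_false_not_mem {l : List Bool} (h : false ∉ l) :
    l = List.replicate l.length true := by
  rw [List.eq_replicate_iff]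
  refine ⟨rfl, fun b hb => ?_⟩
  cases b with
  | true => rfl
  | false => exact absurd hb h

/-- `1ᵏ` contains no `0`. [folklore] -/
theorem false_not_mem_replicate (k : ℕ) : false ∉ List.replicate k true := by
  simp [List.mem_replicate]

/-- A list whose first symbol is `a` is `a` followed by its tail. [folklore] -/
theorem eq_cons_tail_of_take_one {l : List Bool} {a : Bool} (h : l.take 1 = [a]) : l = a :: l.tail := by
  cases l with
  | nil => simp at h
  | cons b t => simp at h; simp [h]

/-- Reading a bit: `(l.drop i).take 1 = [1] ↔ lᵢ = 1` (with default `0`). [folklore] -/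
theorem take_one_drop_eq_iff (l : List Bool) (i : ℕ) :
    (l.drop i).take 1 = [true] ↔ l.getD i false = true := by
  induction l generalizing i with
  | nil => simp
  | cons b t ih =>
    cases i with
    | zero => simp
    | succ i => simp [ih]

/-- The concatenation of copies of `ε` is `ε`. [folklore] -/
theorem flatten_map_const_nil {α : Type} (l : List α) :
    (l.map fun _ => ([] : List Bool)).flatten = [] := by
  rw [List.map_const', List.flatten_replicate_nil]

/-- The concatenation of `k + 1` copies of `a` starts with `a`. [folklore] -/
theorem flatten_map_const_range_succ (a : List Bool) (k : ℕ) :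
    ((List.range (k + 1)).map fun _ => a).flatten = a ++ ((List.range k).map fun _ => a).flatten := by
  rw [List.map_const', List.map_const', List.length_range, List.length_range, List.replicate_succ,
    List.flatten_cons]

/-- The tail is no longer. [folklore] -/
theorem length_tail_le (l : List Bool) : l.tail.length ≤ l.length := by
  rw [List.length_tail]; omega

/-! ### Parsing level strings -/

/-- `s` is addressed to a level: `s = ⟨1ᵐ, rest⟩`. [cite: AaronsonChen2017, Thm. 7.6 (proof, p. 30)] -/
def IsLevel (s : List Bool) : Prop :=
  boolPair (fstP s) (sndP s) = s ∧ false ∉ fstP s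

/-- `s` is an announcement string `ancStr m i = ⟨1ᵐ, 0·1ⁱ⟩`. [cite: AaronsonChen2017, Thm. 7.6 (proof, p. 30)] -/
def IsAnc (s : List Bool) : Prop :=
  IsLevel s ∧ (sndP s).take 1 = [false] ∧ false ∉ (sndP s).tail

/-- `s` is a value string `qryStr m x i = ⟨1ᵐ, 1·⟨x, 1ⁱ⟩⟩`. [cite: AaronsonChen2017, Thm. 7.6 (proof, p. 30)] -/
def IsQry (s : List Bool) : Prop :=
  IsLevel s ∧ (sndP s).take 1 = [true] ∧
    boolPair (fstP (sndP s).tail) (sndP (sndP s).tail) = (sndP s).tail ∧ false ∉ sndP (sndP s).tail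

/-- The level `m` of a level string. [folklore] -/
def lvl (s : List Bool) : ℕ := (fstP s).length

/-- The index `i` of an announcement string. [folklore] -/
def ancIdx (s : List Bool) : ℕ := (sndP s).tail.length

/-- The point `x` of a value string. [folklore] -/
def pt (s : List Bool) : List Bool := fstP (sndP s).tail

/-- The bit index `i` of a value string. [folklore] -/
def qryIdx (s : List Bool) : ℕ := (sndP (sndP s).tail).length

/-- The level tag of `ancStr m i`. [folklore] -/
@[simp] theorem fstP_ancStr (m i : ℕ) : fstP (ancStr m i) = unaryEncodeNat m := by
  simp [ancStr]

/-- The payload of `ancStr m i`. [folklore] -/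
@[simp] theorem sndP_ancStr (m i : ℕ) : sndP (ancStr m i) = false :: unaryEncodeNat i := by
  simp [ancStr]

/-- The level tag of `qryStr m x i`. [folklore] -/
@[simp] theorem fstP_qryStr (m : ℕ) (x : List Bool) (i : ℕ) : fstP (qryStr m x i) = unaryEncodeNat m := by
  simp [qryStr]

/-- The payload of `qryStr m x i`. [folklore] -/
@[simp] theorem sndP_qryStr (m : ℕ) (x : List Bool) (i : ℕ) :
    sndP (qryStr m x i) = true :: boolPair x (unaryEncodeNat i) := by
  simp [qryStr]

/-- Announcement strings parse as announcements. [folklore] -/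
theorem isAnc_ancStr (m i : ℕ) : IsAnc (ancStr m i) := by
  refine ⟨⟨?_, ?_⟩, ?_, ?_⟩
  · rw [fstP_ancStr, sndP_ancStr]; rfl
  · rw [fstP_ancStr, Complexity.unaryEncodeNat_eq_replicate]; exact false_not_mem_replicate m
  · simp
  · rw [sndP_ancStr, List.tail_cons, Complexity.unaryEncodeNat_eq_replicate]; exact false_not_mem_replicate i

/-- Value strings parse as value strings. [folklore] -/
theorem isQry_qryStr (m : ℕ) (x : List Bool) (i : ℕ) : IsQry (qryStr m x i) := by
  refine ⟨⟨?_, ?_⟩, ?_, ?_, ?_⟩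
  · rw [fstP_qryStr, sndP_qryStr]; rfl
  · rw [fstP_qryStr, Complexity.unaryEncodeNat_eq_replicate]; exact false_not_mem_replicate m
  · simp
  · simp
  · rw [sndP_qryStr, List.tail_cons, sndP_boolPair, Complexity.unaryEncodeNat_eq_replicate]
    exact false_not_mem_replicate i

/-- The parse of `ancStr m i`: level `m`. [folklore] -/
@[simp] theorem lvl_ancStr (m i : ℕ) : lvl (ancStr m i) = m := by
  simp [lvl, Complexity.unaryEncodeNat_eq_replicate]

/-- The parse of `ancStr m i`: index `i`. [folklore] -/
@[simp] theorem ancIdx_ancStr (m i : ℕ) : ancIdx (ancStr m i) = i := by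
  simp [ancIdx, Complexity.unaryEncodeNat_eq_replicate]

/-- The parse of `qryStr m x i`: level `m`. [folklore] -/
@[simp] theorem lvl_qryStr (m : ℕ) (x : List Bool) (i : ℕ) : lvl (qryStr m x i) = m := by
  simp [lvl, Complexity.unaryEncodeNat_eq_replicate]

/-- The parse of `qryStr m x i`: point `x`. [folklore] -/
@[simp] theorem pt_qryStr (m : ℕ) (x : List Bool) (i : ℕ) : pt (qryStr m x i) = x := by
  simp [pt]

/-- The parse of `qryStr m x i`: bit index `i`. [folklore] -/
@[simp] theorem qryIdx_qryStr (m : ℕ) (x : List Bool) (i : ℕ) : qryIdx (qryStr m x i) = i := by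
  simp [qryIdx, Complexity.unaryEncodeNat_eq_replicate]

/-- A level string has the tag `1^{lvl s}`. [folklore] -/
theorem fstP_eq_of_isLevel {s : List Bool} (h : IsLevel s) : fstP s = unaryEncodeNat (lvl s) := by
  rw [Complexity.unaryEncodeNat_eq_replicate]
  exact eq_replicate_of_false_not_mem h.2

/-- **An announcement-shaped string is `ancStr (lvl s) (ancIdx s)`.** [folklore] -/
theorem eq_ancStr_of_isAnc {s : List Bool} (h : IsAnc s) : s = ancStr (lvl s) (ancIdx s) := by
  obtain ⟨hl, h1, h2⟩ := h
  have hrest : sndP s = false :: unaryEncodeNat (ancIdx s) := by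
    rw [eq_cons_tail_of_take_one h1, Complexity.unaryEncodeNat_eq_replicate]
    exact congrArg (List.cons false) (eq_replicate_of_false_not_mem h2)
  conv_lhs => rw [← hl.1, fstP_eq_of_isLevel hl, hrest]
  rfl

/-- **A value-shaped string is `qryStr (lvl s) (pt s) (qryIdx s)`.** [folklore] -/
theorem eq_qryStr_of_isQry {s : List Bool} (h : IsQry s) : s = qryStr (lvl s) (pt s) (qryIdx s) := by
  obtain ⟨hl, h1, h2, h3⟩ := h
  have htail : (sndP s).tail = boolPair (pt s) (unaryEncodeNat (qryIdx s)) := by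
    rw [← h2, Complexity.unaryEncodeNat_eq_replicate]
    exact congrArg (boolPair _) (eq_replicate_of_false_not_mem h3)
  have hrest : sndP s = true :: boolPair (pt s) (unaryEncodeNat (qryIdx s)) := by
    rw [eq_cons_tail_of_take_one h1, htail]
  conv_lhs => rw [← hl.1, fstP_eq_of_isLevel hl, hrest]
  rfl

/-- Announcement and value shapes are exclusive. [folklore] -/
theorem not_isQry_of_isAnc {s : List Bool} (h : IsAnc s) : ¬ IsQry s := fun h' => by
  have h1 := h.2.1
  rw [h'.2.1] at h1
  simp at h1

/-- **Membership in a level block, by the parse.** `s ∈ levelStrings m j g` iff `s` is an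
announcement of level `m` with index `< j`, or a value string of level `m` with point of length
`j`, bit index `i < j` and bit `i` of `g (pt s)` set.
[cite: AaronsonChen2017, Thm. 7.6 (proof, p. 30)] -/
theorem mem_levelStrings_iff_parse (m j : ℕ) (g : List Bool → List Bool) (s : List Bool) :
    s ∈ levelStrings m j g ↔
      (IsAnc s ∧ lvl s = m ∧ ancIdx s < j) ∨
        (IsQry s ∧ lvl s = m ∧ (pt s).length = j ∧ qryIdx s < j ∧
          (g (pt s)).getD (qryIdx s) false = true) := by
  constructor
  · rintro (⟨i, hi, rfl⟩ | ⟨x, i, hx, hi, hb, rfl⟩)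
    · exact Or.inl ⟨isAnc_ancStr m i, lvl_ancStr m i, by rwa [ancIdx_ancStr]⟩
    · refine Or.inr ⟨isQry_qryStr m x i, lvl_qryStr m x i, by rwa [pt_qryStr], by rwa [qryIdx_qryStr], ?_⟩
      rwa [pt_qryStr, qryIdx_qryStr]
  · rintro (⟨hs, hm, hi⟩ | ⟨hs, hm, hx, hi, hb⟩)
    · exact Or.inl ⟨ancIdx s, hi, by rw [← hm]; exact eq_ancStr_of_isAnc hs⟩
    · exact Or.inr ⟨pt s, qryIdx s, hx, hi, hb, by rw [← hm]; exact eq_qryStr_of_isQry hs⟩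

/-! ### Accessors on `w = ⟨⟨z, s⟩, e⟩` -/

/-- The query `s` of `M` read off `⟨⟨z, s⟩, e⟩`. [folklore] -/
def sZ : List Bool → List Bool := sndP ∘ fstP
/-- The probe `1ⁿ` (first field of the input `z = ⟨1ⁿ, r⟩` of `M`) read off `⟨⟨z, s⟩, e⟩`. [folklore] -/
def nZ : List Bool → List Bool := fstP ∘ fstP ∘ fstP
/-- The extra field `e` (concatenated oracle answers, or the query counter `1ᵏ`). [folklore] -/
def eZ : List Bool → List Bool := sndP
/-- The level tag `1ᵐ` of `s`. [folklore] -/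
def tagZ : List Bool → List Bool := fstP ∘ sZ
/-- The payload of `s`. [folklore] -/
def restZ : List Bool → List Bool := sndP ∘ sZ
/-- The payload of `s` without its type bit. [folklore] -/
def bodyZ : List Bool → List Bool := List.tail ∘ restZ
/-- The point `x` of a value string `s`. [folklore] -/
def xZ : List Bool → List Bool := fstP ∘ bodyZ
/-- The bit index `1ⁱ` of a value string `s`. [folklore] -/
def idxZ : List Bool → List Bool := sndP ∘ bodyZ

/-- `sZ ∈ FP`. [folklore] -/
theorem sZ_mem_FP : sZ ∈ FP := comp_mem_FP sndP_mem_FP fstP_mem_FP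
/-- `nZ ∈ FP`. [folklore] -/
theorem nZ_mem_FP : nZ ∈ FP := comp_mem_FP fstP_mem_FP (comp_mem_FP fstP_mem_FP fstP_mem_FP)
/-- `eZ ∈ FP`. [folklore] -/
theorem eZ_mem_FP : eZ ∈ FP := sndP_mem_FP
/-- `tagZ ∈ FP`. [folklore] -/
theorem tagZ_mem_FP : tagZ ∈ FP := comp_mem_FP fstP_mem_FP sZ_mem_FP
/-- `restZ ∈ FP`. [folklore] -/
theorem restZ_mem_FP : restZ ∈ FP := comp_mem_FP sndP_mem_FP sZ_mem_FP
/-- `bodyZ ∈ FP`. [folklore] -/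
theorem bodyZ_mem_FP : bodyZ ∈ FP := comp_mem_FP PRelSigma.tail_mem_FP restZ_mem_FP
/-- `xZ ∈ FP`. [folklore] -/
theorem xZ_mem_FP : xZ ∈ FP := comp_mem_FP fstP_mem_FP bodyZ_mem_FP
/-- `idxZ ∈ FP`. [folklore] -/
theorem idxZ_mem_FP : idxZ ∈ FP := comp_mem_FP sndP_mem_FP bodyZ_mem_FP

section Apply

variable (z s e : List Bool)

/-- Value of `sZ`. [folklore] -/
@[simp] theorem sZ_apply : sZ (boolPair (boolPair z s) e) = s := by simp [sZ]
/-- Value of `eZ`. [folklore] -/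
@[simp] theorem eZ_apply : eZ (boolPair (boolPair z s) e) = e := by simp [eZ]
/-- Value of `tagZ`. [folklore] -/
@[simp] theorem tagZ_apply : tagZ (boolPair (boolPair z s) e) = fstP s := by simp [tagZ, sZ]
/-- Value of `restZ`. [folklore] -/
@[simp] theorem restZ_apply : restZ (boolPair (boolPair z s) e) = sndP s := by simp [restZ, sZ]
/-- Value of `bodyZ`. [folklore] -/
@[simp] theorem bodyZ_apply : bodyZ (boolPair (boolPair z s) e) = (sndP s).tail := by
  simp [bodyZ, restZ, sZ]
/-- Value of `xZ`. [folklore] -/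
@[simp] theorem xZ_apply : xZ (boolPair (boolPair z s) e) = pt s := by
  simp [xZ, bodyZ, restZ, sZ, pt]
/-- Value of `idxZ`. [folklore] -/
@[simp] theorem idxZ_apply : idxZ (boolPair (boolPair z s) e) = sndP (sndP s).tail := by
  simp [idxZ, bodyZ, restZ, sZ]
/-- Value of `nZ` on a genuine input `z = ⟨1ⁿ, r⟩`. [folklore] -/
@[simp] theorem nZ_apply (n : ℕ) (r : List Bool) :
    nZ (boolPair (boolPair (boolPair (unaryEncodeNat n) r) s) e) = unaryEncodeNat n := by
  simp [nZ]

end Apply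

/-! ### Finite patching: finite sets and finite sets of lengths are in `P` -/

/-- The language of a finite set of strings. [folklore] -/
def LFin (T : Finset (List Bool)) : Language Bool := {w | w ∈ T}

/-- Membership in `LFin`. [folklore] -/
@[simp] theorem mem_LFin {T : Finset (List Bool)} {w : List Bool} : w ∈ LFin T ↔ w ∈ T := Iff.rfl

/-- **A finite language is in `P`** (hard-wire it: `FP` is closed under finite patching,
`mem_FP_of_eqOn_le`). [Arora–Barak 2009, §1.3 (closure of polynomial time), Claim 1.6] [cite: AroraBarak2009, §1.3] -/
theorem LFin_mem_P (T : Finset (List Bool)) : LFin T ∈ Classes.P := by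
  classical
  have hg : (fun w : List Bool => [decide (w ∈ T)]) ∈ FP := by
    refine mem_FP_of_eqOn_le (const_mem_FP [false]) (T.sup List.length + 1) fun w hw => ?_
    have : w ∉ T := fun h => by
      have := Finset.le_sup (f := List.length) h
      omega
    simp [this]
  exact mem_P_of_mem_FP hg _ fun w => ⟨fun h => by simpa using h, fun h => by simpa using h⟩

/-- The language of strings whose LENGTH lies in a finite set. [folklore] -/
def LenMem (E : Finset ℕ) : Language Bool := {w | w.length ∈ E}

/-- Membership in `LenMem`. [folklore] -/
@[simp] theorem mem_LenMem {E : Finset ℕ} {w : List Bool} : w ∈ LenMem E ↔ w.length ∈ E := Iff.rfl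

/-- `LenMem E ∈ P` (finite patching again). [Arora–Barak 2009, §1.3] [cite: AroraBarak2009, §1.3] -/
theorem LenMem_mem_P (E : Finset ℕ) : LenMem E ∈ Classes.P := by
  classical
  have hg : (fun w : List Bool => [decide (w.length ∈ E)]) ∈ FP := by
    refine mem_FP_of_eqOn_le (const_mem_FP [false]) (E.sup id + 1) fun w hw => ?_
    have : w.length ∉ E := fun h => by
      have := Finset.le_sup (f := id) h
      simp only [id] at this
      omega
    simp [this]
  exact mem_P_of_mem_FP hg _ fun w => ⟨fun h => by simpa using h, fun h => by simpa using h⟩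

/-! ### The test languages -/

/-- Test: `s` is a level string. [folklore] -/
def LLevel : Language Bool := {w | pairFn tagZ restZ w = sZ w} ⊓ (tagZ ⁻¹' NoBit false)

/-- Test: `s` is announcement-shaped. [folklore] -/
def LAnc : Language Bool :=
  LLevel ⊓ {w | (take1Fn ∘ restZ) w = (fun _ => [false]) w} ⊓ (bodyZ ⁻¹' NoBit false)

/-- Test: `s` is value-shaped. [folklore] -/
def LQry : Language Bool :=
  LLevel ⊓ {w | (take1Fn ∘ restZ) w = (fun _ => [true]) w} ⊓ {w | pairFn xZ idxZ w = bodyZ w} ⊓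
    (idxZ ⁻¹' NoBit false)

/-- Test: the level tag of `s` is the probe `1ⁿ` (the level under test). [folklore] -/
def LLevN : Language Bool := {w | tagZ w = nZ w}

/-- Test: the level of `s` is one of the hard-wired levels `E`. [folklore] -/
def LTagE (E : Finset ℕ) : Language Bool := tagZ ⁻¹' LenMem E

/-- Test: `s` is one of the hard-wired strings `T`. [folklore] -/
def LInT (T : Finset (List Bool)) : Language Bool := sZ ⁻¹' LFin T

/-- Test: `|s| ≤ q |z|` (the cut-off of the simulated oracle). [folklore] -/
def LLenOK (q : Polynomial ℕ) : Language Bool := fstP ⁻¹' LenLe q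

/-- Filler test for announcements: `ancIdx s < lvl s`. [folklore] -/
def LFAnc : Language Bool := pairFn tagZ bodyZ ⁻¹' LenLt X

/-- Filler test for value strings: `|pt s| = lvl s`, `qryIdx s < lvl s`, bit `qryIdx s` of `pt s`
set. [folklore] -/
def LFQry : Language Bool :=
  (pairFn tagZ xZ ⁻¹' LenEq X) ⊓ (pairFn tagZ idxZ ⁻¹' LenLt X) ⊓
    {w | (bitAtFn ∘ pairFn idxZ xZ) w = (fun _ => [true]) w}

/-- Level-`n` test for announcements: the concatenated answers are nonempty. [folklore] -/
def LNAnc : Language Bool := {w | eZ w = (fun _ => []) w}ᶜ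

/-- Level-`n` test for value strings: answers nonempty, `qryIdx s < |pt s|`, bit `qryIdx s` of
the answers set. [folklore] -/
def LNQry : Language Bool :=
  LNAnc ⊓ (pairFn xZ idxZ ⁻¹' LenLt X) ⊓ {w | (bitAtFn ∘ pairFn idxZ eZ) w = (fun _ => [true]) w}

/-- **The evaluator language**: on `⟨⟨z, s⟩, answers⟩`, the verdict
`[s ∈ specLang E T n j f ∧ |s| ≤ q |z|]` as computed from the parse of `s` and the answers.
[cite: AaronsonChen2017, Thm. 7.6 (proof, p. 30)] -/
def simLang (q : Polynomial ℕ) (E : Finset ℕ) (T : Finset (List Bool)) : Language Bool :=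
  LLenOK q ⊓ (LInT T ⊔ ((LLevN ⊓ ((LAnc ⊓ LNAnc) ⊔ (LQry ⊓ LNQry))) ⊔
    ((LTagE E)ᶜ ⊓ LLevNᶜ ⊓ ((LAnc ⊓ LFAnc) ⊔ (LQry ⊓ LFQry)))))

/-- `LLevel ∈ P`. [folklore] -/
theorem LLevel_mem_P : LLevel ∈ Classes.P :=
  inter_mem_P (setOf_apply_eq_apply_mem_P (pairFn_mem_FP tagZ_mem_FP restZ_mem_FP) sZ_mem_FP)
    (preimage_mem_P (NoBit_mem_P false) tagZ_mem_FP)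

/-- `LAnc ∈ P`. [folklore] -/
theorem LAnc_mem_P : LAnc ∈ Classes.P :=
  inter_mem_P (inter_mem_P LLevel_mem_P
    (setOf_apply_eq_apply_mem_P (comp_mem_FP take1Fn_mem_FP restZ_mem_FP) (const_mem_FP _)))
    (preimage_mem_P (NoBit_mem_P false) bodyZ_mem_FP)

/-- `LQry ∈ P`. [folklore] -/
theorem LQry_mem_P : LQry ∈ Classes.P :=
  inter_mem_P (inter_mem_P (inter_mem_P LLevel_mem_P
    (setOf_apply_eq_apply_mem_P (comp_mem_FP take1Fn_mem_FP restZ_mem_FP) (const_mem_FP _)))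
    (setOf_apply_eq_apply_mem_P (pairFn_mem_FP xZ_mem_FP idxZ_mem_FP) bodyZ_mem_FP))
    (preimage_mem_P (NoBit_mem_P false) idxZ_mem_FP)

/-- `LLevN ∈ P`. [folklore] -/
theorem LLevN_mem_P : LLevN ∈ Classes.P := setOf_apply_eq_apply_mem_P tagZ_mem_FP nZ_mem_FP

/-- `LTagE E ∈ P`. [folklore] -/
theorem LTagE_mem_P (E : Finset ℕ) : LTagE E ∈ Classes.P := preimage_mem_P (LenMem_mem_P E) tagZ_mem_FP

/-- `LInT T ∈ P`. [folklore] -/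
theorem LInT_mem_P (T : Finset (List Bool)) : LInT T ∈ Classes.P :=
  preimage_mem_P (LFin_mem_P T) sZ_mem_FP

/-- `LLenOK q ∈ P`. [folklore] -/
theorem LLenOK_mem_P (q : Polynomial ℕ) : LLenOK q ∈ Classes.P := preimage_mem_P (LenLe_mem_P q) fstP_mem_FP

/-- `LFAnc ∈ P`. [folklore] -/
theorem LFAnc_mem_P : LFAnc ∈ Classes.P :=
  preimage_mem_P (LenLt_mem_P X) (pairFn_mem_FP tagZ_mem_FP bodyZ_mem_FP)

/-- `LFQry ∈ P`. [folklore] -/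
theorem LFQry_mem_P : LFQry ∈ Classes.P :=
  inter_mem_P (inter_mem_P (preimage_mem_P (LenEq_mem_P X) (pairFn_mem_FP tagZ_mem_FP xZ_mem_FP))
    (preimage_mem_P (LenLt_mem_P X) (pairFn_mem_FP tagZ_mem_FP idxZ_mem_FP)))
    (setOf_apply_eq_apply_mem_P (comp_mem_FP bitAtFn_mem_FP (pairFn_mem_FP idxZ_mem_FP xZ_mem_FP))
      (const_mem_FP _))

/-- `LNAnc ∈ P`. [folklore] -/
theorem LNAnc_mem_P : LNAnc ∈ Classes.P :=
  compl_mem_P_iff.2 (setOf_apply_eq_apply_mem_P eZ_mem_FP (const_mem_FP _))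

/-- `LNQry ∈ P`. [folklore] -/
theorem LNQry_mem_P : LNQry ∈ Classes.P :=
  inter_mem_P (inter_mem_P LNAnc_mem_P (preimage_mem_P (LenLt_mem_P X) (pairFn_mem_FP xZ_mem_FP idxZ_mem_FP)))
    (setOf_apply_eq_apply_mem_P (comp_mem_FP bitAtFn_mem_FP (pairFn_mem_FP idxZ_mem_FP eZ_mem_FP))
      (const_mem_FP _))

/-- **The evaluator language is in `P`.** [Arora–Barak 2009, §1.3] [cite: AroraBarak2009, §1.3] -/
theorem simLang_mem_P (q : Polynomial ℕ) (E : Finset ℕ) (T : Finset (List Bool)) :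
    simLang q E T ∈ Classes.P :=
  inter_mem_P (LLenOK_mem_P q) (union_mem_P (LInT_mem_P T) (union_mem_P
    (inter_mem_P LLevN_mem_P (union_mem_P (inter_mem_P LAnc_mem_P LNAnc_mem_P)
      (inter_mem_P LQry_mem_P LNQry_mem_P)))
    (inter_mem_P (inter_mem_P (compl_mem_P_iff.2 (LTagE_mem_P E)) (compl_mem_P_iff.2 LLevN_mem_P))
      (union_mem_P (inter_mem_P LAnc_mem_P LFAnc_mem_P) (inter_mem_P LQry_mem_P LFQry_mem_P)))))

/-! ### Reading the tests -/

section Reading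

variable (z s e : List Bool)

/-- Reading `LLevel`. [folklore] -/
theorem mem_LLevel_iff : boolPair (boolPair z s) e ∈ LLevel ↔ IsLevel s := by
  simp only [LLevel, memL_inf, memL_setOf, memL_preimage, mem_NoBit, pairFn_apply, tagZ_apply, restZ_apply,
    sZ_apply]
  rfl

/-- Reading `LAnc`. [folklore] -/
theorem mem_LAnc_iff : boolPair (boolPair z s) e ∈ LAnc ↔ IsAnc s := by
  simp only [LAnc, memL_inf, memL_setOf, memL_preimage, mem_LLevel_iff, mem_NoBit, Function.comp_apply,
    restZ_apply, bodyZ_apply, take1Fn, and_assoc]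
  rfl

/-- Reading `LQry`. [folklore] -/
theorem mem_LQry_iff : boolPair (boolPair z s) e ∈ LQry ↔ IsQry s := by
  simp only [LQry, memL_inf, memL_setOf, memL_preimage, mem_LLevel_iff, mem_NoBit, Function.comp_apply,
    restZ_apply, bodyZ_apply, pairFn_apply, xZ_apply, idxZ_apply, take1Fn, and_assoc]
  rfl

/-- Reading `LLevN` on a genuine input. [folklore] -/
theorem mem_LLevN_iff (n : ℕ) (r : List Bool) :
    boolPair (boolPair (boolPair (unaryEncodeNat n) r) s) e ∈ LLevN ↔ fstP s = unaryEncodeNat n := by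
  simp only [LLevN, memL_setOf, tagZ_apply, nZ_apply]

/-- Reading `LTagE`. [folklore] -/
theorem mem_LTagE_iff (E : Finset ℕ) : boolPair (boolPair z s) e ∈ LTagE E ↔ lvl s ∈ E := by
  simp only [LTagE, memL_preimage, mem_LenMem, tagZ_apply]
  rfl

/-- Reading `LInT`. [folklore] -/
theorem mem_LInT_iff (T : Finset (List Bool)) : boolPair (boolPair z s) e ∈ LInT T ↔ s ∈ T := by
  simp only [LInT, memL_preimage, mem_LFin, sZ_apply]

/-- Reading `LLenOK`. [folklore] -/
theorem mem_LLenOK_iff (q : Polynomial ℕ) :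
    boolPair (boolPair z s) e ∈ LLenOK q ↔ s.length ≤ q.eval z.length := by
  simp only [LLenOK, memL_preimage, fstP_boolPair, boolPair_mem_LenLe]

/-- Reading `LFAnc`. [folklore] -/
theorem mem_LFAnc_iff : boolPair (boolPair z s) e ∈ LFAnc ↔ ancIdx s < lvl s := by
  simp only [LFAnc, memL_preimage, pairFn_apply, tagZ_apply, bodyZ_apply, boolPair_mem_LenLt, eval_X]
  rfl

/-- Reading `LFQry`. [folklore] -/
theorem mem_LFQry_iff : boolPair (boolPair z s) e ∈ LFQry ↔
    (pt s).length = lvl s ∧ qryIdx s < lvl s ∧ (pt s).getD (qryIdx s) false = true := by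
  simp only [LFQry, memL_inf, memL_setOf, memL_preimage, pairFn_apply, Function.comp_apply, tagZ_apply,
    xZ_apply, idxZ_apply, boolPair_mem_LenEq, boolPair_mem_LenLt, eval_X, bitAtFn_boolPair,
    take_one_drop_eq_iff, and_assoc]
  rfl

/-- Reading `LNAnc`. [folklore] -/
theorem mem_LNAnc_iff : boolPair (boolPair z s) e ∈ LNAnc ↔ e ≠ [] := by
  simp only [LNAnc, PPSharpP.memL_compl, memL_setOf, eZ_apply]

/-- Reading `LNQry`. [folklore] -/
theorem mem_LNQry_iff : boolPair (boolPair z s) e ∈ LNQry ↔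
    e ≠ [] ∧ qryIdx s < (pt s).length ∧ e.getD (qryIdx s) false = true := by
  simp only [LNQry, memL_inf, memL_setOf, memL_preimage, mem_LNAnc_iff, pairFn_apply, Function.comp_apply,
    xZ_apply, idxZ_apply, eZ_apply, boolPair_mem_LenLt, eval_X, bitAtFn_boolPair, take_one_drop_eq_iff,
    and_assoc]
  rfl

/-- **Reading the evaluator language** on a genuine input `⟨⟨⟨1ⁿ, r⟩, s⟩, e⟩`. [folklore] -/
theorem mem_simLang_iff (q : Polynomial ℕ) (E : Finset ℕ) (T : Finset (List Bool)) (n : ℕ) (r : List Bool) :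
    boolPair (boolPair (boolPair (unaryEncodeNat n) r) s) e ∈ simLang q E T ↔
      s.length ≤ q.eval (boolPair (unaryEncodeNat n) r).length ∧
        (s ∈ T ∨
          (fstP s = unaryEncodeNat n ∧
            ((IsAnc s ∧ e ≠ []) ∨
              (IsQry s ∧ e ≠ [] ∧ qryIdx s < (pt s).length ∧ e.getD (qryIdx s) false = true))) ∨
          (lvl s ∉ E ∧ fstP s ≠ unaryEncodeNat n ∧
            ((IsAnc s ∧ ancIdx s < lvl s) ∨
              (IsQry s ∧ (pt s).length = lvl s ∧ qryIdx s < lvl s ∧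
                (pt s).getD (qryIdx s) false = true)))) := by
  simp only [simLang, memL_inf, memL_sup, PPSharpP.memL_compl, mem_LLenOK_iff, mem_LInT_iff, mem_LLevN_iff,
    mem_LAnc_iff, mem_LNAnc_iff, mem_LQry_iff, mem_LNQry_iff, mem_LTagE_iff, mem_LFAnc_iff, mem_LFQry_iff,
    and_assoc]

end Reading

/-! ### The query generator, the evaluator, the simulator -/

/-- **The query generator**: on `⟨⟨z, s⟩, 1ᵏ⟩`, the `k`-th query — the point `x` of a value
string of the level under test, the probe `1^{i+1+k}` for an announcement `ancStr n i` of the level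
under test, and the dummy `ε` otherwise. [cite: AaronsonChen2017, Thm. 7.6 (proof, p. 30)] -/
noncomputable def simQ : List Bool → List Bool :=
  condFn (LQry ⊓ LLevN) xZ (condFn (LAnc ⊓ LLevN) (fun w => bodyZ w ++ (List.cons true ∘ eZ) w) fun _ => [])

/-- **The evaluator**: the indicator of `simLang`. [folklore] -/
noncomputable def simG (q : Polynomial ℕ) (E : Finset ℕ) (T : Finset (List Bool)) : List Bool → List Bool :=
  fun w => encodeBool ((simLang q E T).boolIndicator w)

/-- **The simulator** `simN q B E T = ttFnAlg simQ B (simG q E T)`: ask the `B |u|` queries of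
`simQ`, then output the verdict of `simG` on the input and the concatenated answers.
[cite: AaronsonChen2017, Thm. 7.6 (proof, p. 30)] [cite: LadnerLynchSelman1975, §3] -/
noncomputable def simN (q B : Polynomial ℕ) (E : Finset ℕ) (T : Finset (List Bool)) : OracleAlg (List Bool) :=
  ttFnAlg simQ B (simG q E T)

/-- `simQ ∈ FP`. [Arora–Barak 2009, §1.3] [cite: AroraBarak2009, §1.3] -/
theorem simQ_mem_FP : simQ ∈ FP :=
  condFn_mem_FP (inter_mem_P LQry_mem_P LLevN_mem_P) xZ_mem_FP
    (condFn_mem_FP (inter_mem_P LAnc_mem_P LLevN_mem_P)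
      (append_mem_FP bodyZ_mem_FP (comp_mem_FP (cons_mem_FP true) eZ_mem_FP)) (const_mem_FP _))

/-- `simG q E T ∈ FP`. [Arora–Barak 2009, Def. 1.13] [cite: AroraBarak2009, §1.3] -/
theorem simG_mem_FP (q : Polynomial ℕ) (E : Finset ℕ) (T : Finset (List Bool)) : simG q E T ∈ FP :=
  indicatorFn_mem_FP (simLang_mem_P q E T)

/-- **The simulator is polynomial-time.** [cite: LadnerLynchSelman1975, §3] -/
theorem isPolyTime_simN (q B : Polynomial ℕ) (E : Finset ℕ) (T : Finset (List Bool)) :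
    (simN q B E T).IsPolyTime (encodingList Bool) :=
  isPolyTime_ttFnAlg simQ_mem_FP (simG_mem_FP q E T)

open scoped Classical in
/-- The value of the query generator on a genuine input. [folklore] -/
theorem simQ_apply (n : ℕ) (r s : List Bool) (k : ℕ) :
    simQ (boolPair (boolPair (boolPair (unaryEncodeNat n) r) s) (List.replicate k true)) =
      if IsQry s ∧ fstP s = unaryEncodeNat n then pt s
      else if IsAnc s ∧ fstP s = unaryEncodeNat n then (sndP s).tail ++ (true :: List.replicate k true)
      else [] := by
  unfold simQ
  have hQ : boolPair (boolPair (boolPair (unaryEncodeNat n) r) s) (List.replicate k true) ∈ LQry ⊓ LLevN ↔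
      IsQry s ∧ fstP s = unaryEncodeNat n := by
    rw [memL_inf, mem_LQry_iff, mem_LLevN_iff]
  have hA : boolPair (boolPair (boolPair (unaryEncodeNat n) r) s) (List.replicate k true) ∈ LAnc ⊓ LLevN ↔
      IsAnc s ∧ fstP s = unaryEncodeNat n := by
    rw [memL_inf, mem_LAnc_iff, mem_LLevN_iff]
  by_cases h1 : IsQry s ∧ fstP s = unaryEncodeNat n
  · rw [condFn_of_mem _ _ (hQ.2 h1), if_pos h1, xZ_apply]
  · rw [condFn_of_not_mem _ _ (fun h => h1 (hQ.1 h)), if_neg h1]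
    by_cases h2 : IsAnc s ∧ fstP s = unaryEncodeNat n
    · rw [condFn_of_mem _ _ (hA.2 h2), if_pos h2, bodyZ_apply, Function.comp_apply, eZ_apply]
    · rw [condFn_of_not_mem _ _ (fun h => h2 (hA.1 h)), if_neg h2]

/-- Every query of the generator is short: `|simQ ⟨u, 1ᵏ⟩| ≤ |u| + k + 1`. [folklore] -/
theorem length_simQ_le (u : List Bool) (k : ℕ) :
    (simQ (boolPair u (List.replicate k true))).length ≤ u.length + k + 1 := by
  have hbody : (bodyZ (boolPair u (List.replicate k true))).length ≤ u.length := by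
    simp only [bodyZ, restZ, sZ, Function.comp_apply, fstP_boolPair]
    exact (length_tail_le _).trans ((length_boolUnpair_snd_le_length _).trans (length_boolUnpair_snd_le_length u))
  have hx : (xZ (boolPair u (List.replicate k true))).length ≤ u.length :=
    (length_fstP_le _).trans hbody
  unfold simQ
  rw [condFn_apply]
  split_ifs
  · omega
  · rw [condFn_apply]
    split_ifs
    · simp only [Function.comp_apply, eZ, sndP_boolPair, List.length_append, List.length_cons,
        List.length_replicate]
      omega
    · simp

/-! ### The intermediate oracle and the answers of `f` -/

/-- **The intermediate oracle** presented to the (query-tagged) machine `M`: on `u = ⟨z, s⟩` the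
bit `[s ∈ specLang E T n j f ∧ |s| ≤ q |z|]` — the oracle `specLang E T n j f` of the stage, cut
off at the query bound, with the input `z` of `M` carried along.
[cite: AaronsonChen2017, Thm. 7.6 (proof, p. 30)] -/
noncomputable def midOracle (q : Polynomial ℕ) (E : Finset ℕ) (T : Finset (List Bool)) (n j : ℕ)
    (f : List Bool → List Bool) : Oracle :=
  Oracle.ofLanguage {u | sndP u ∈ specLang E T n j f ∧ (sndP u).length ≤ q.eval (fstP u).length}

/-- The value of the intermediate oracle on a pair. [folklore] -/
theorem midOracle_boolPair (q : Polynomial ℕ) (E : Finset ℕ) (T : Finset (List Bool)) (n j : ℕ)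
    (f : List Bool → List Bool) (z s : List Bool) :
    midOracle q E T n j f (boolPair z s) =
      [({s | s ∈ specLang E T n j f ∧ s.length ≤ q.eval z.length} : Language Bool).boolIndicator s] := by
  unfold midOracle
  rw [ofLanguage_eq_singleton]
  congr 1
  by_cases h : s ∈ specLang E T n j f ∧ s.length ≤ q.eval z.length
  · rw [(Set.mem_iff_boolIndicator _ _).1 (show boolPair z s ∈ ({u | sndP u ∈ specLang E T n j f ∧
        (sndP u).length ≤ q.eval (fstP u).length} : Language Bool) by simpa using h),
      (Set.mem_iff_boolIndicator _ _).1 (show s ∈ ({s | s ∈ specLang E T n j f ∧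
        s.length ≤ q.eval z.length} : Language Bool) from h)]
  · rw [(Set.notMem_iff_boolIndicator _ _).1 (show boolPair z s ∉ ({u | sndP u ∈ specLang E T n j f ∧
        (sndP u).length ≤ q.eval (fstP u).length} : Language Bool) by simpa using h),
      (Set.notMem_iff_boolIndicator _ _).1 (show s ∉ ({s | s ∈ specLang E T n j f ∧
        s.length ≤ q.eval z.length} : Language Bool) from h)]

/-- The concatenated answers of the oracle `O` to the `K` queries of `simQ` on `u`. [folklore] -/
noncomputable def probeAnswers (O : Oracle) (u : List Bool) (K : ℕ) : List Bool :=
  ((List.range K).map fun k => O (simQ (boolPair u (List.replicate k true)))).flatten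

section Answers

variable {j : ℕ} {f : List Bool → List Bool} (hj : 1 ≤ j)
  (hf : ∀ y : List Bool, y.length = j → (f y).length = j)
include hj hf

/-- `oracleOfFnAt j f` answers nonempty exactly on queries of length `j`. [folklore] -/
theorem oracleOfFnAt_ne_nil_iff (y : List Bool) : oracleOfFnAt j f y ≠ [] ↔ y.length = j := by
  by_cases hy : y.length = j
  · rw [oracleOfFnAt_apply_of_length_eq f hy]
    simp only [hy, iff_true]
    intro h
    have := hf y hy
    rw [h] at this
    simp at this
    omega
  · rw [oracleOfFnAt_apply_of_length_ne f hy]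
    simp [hy]

/-- **The answers on a value string of the level under test**: the `K` queries are all `pt s`; the
concatenated answers are empty if `|pt s| ≠ j`, and otherwise start with `f (pt s)` (of length
`j`). [cite: AaronsonChen2017, Thm. 7.6 (proof, p. 30)] -/
theorem answers_qry (n : ℕ) (r s : List Bool) (hs : IsQry s ∧ fstP s = unaryEncodeNat n) (K : ℕ) (hK : 1 ≤ K) :
    (probeAnswers (oracleOfFnAt j f) (boolPair (boolPair (unaryEncodeNat n) r) s) K ≠ [] ↔ (pt s).length = j) ∧
      ((pt s).length = j → ∀ i < j,
        (probeAnswers (oracleOfFnAt j f) (boolPair (boolPair (unaryEncodeNat n) r) s) K).getD i false =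
          (f (pt s)).getD i false) := by
  have hfl : probeAnswers (oracleOfFnAt j f) (boolPair (boolPair (unaryEncodeNat n) r) s) K =
      ((List.range K).map fun _ => oracleOfFnAt j f (pt s)).flatten := by
    simp only [probeAnswers, simQ_apply, if_pos hs]
  obtain ⟨K', rfl⟩ : ∃ K', K = K' + 1 := ⟨K - 1, by omega⟩
  rw [flatten_map_const_range_succ] at hfl
  rw [hfl]
  by_cases hx : (pt s).length = j
  · have ha : oracleOfFnAt j f (pt s) = f (pt s) := oracleOfFnAt_apply_of_length_eq f hx
    have hlen : (f (pt s)).length = j := hf _ hx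
    rw [ha]
    refine ⟨⟨fun _ => hx, fun _ h => ?_⟩, fun _ i hi => ?_⟩
    · rw [List.append_eq_nil_iff] at h
      rw [h.1] at hlen
      simp at hlen
      omega
    · rw [List.getD_eq_getElem?_getD, List.getElem?_append_left (by rw [hlen]; exact hi),
        ← List.getD_eq_getElem?_getD]
  · have ha : oracleOfFnAt j f (pt s) = [] := oracleOfFnAt_apply_of_length_ne f hx
    rw [ha, List.nil_append, flatten_map_const_nil]
    exact ⟨⟨fun h => absurd rfl h, fun h => absurd h hx⟩, fun h => absurd h hx⟩

/-- **The answers on an announcement of the level under test**: the `k`-th query is the probe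
`1^{ancIdx s + 1 + k}`; with `K ≥ j` probes the concatenated answers are nonempty iff
`ancIdx s < j`. [cite: AaronsonChen2017, Thm. 7.6 (proof, p. 30)] -/
theorem answers_anc (n : ℕ) (r s : List Bool) (hs : IsAnc s ∧ fstP s = unaryEncodeNat n) (K : ℕ) (hK : j ≤ K) :
    probeAnswers (oracleOfFnAt j f) (boolPair (boolPair (unaryEncodeNat n) r) s) K ≠ [] ↔ ancIdx s < j := by
  have hnq : ¬ (IsQry s ∧ fstP s = unaryEncodeNat n) := fun h => not_isQry_of_isAnc hs.1 h.1
  have htail : (sndP s).tail = List.replicate (ancIdx s) true := eq_replicate_of_false_not_mem hs.1.2.2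
  have hq : ∀ k, simQ (boolPair (boolPair (boolPair (unaryEncodeNat n) r) s) (List.replicate k true)) =
      List.replicate (ancIdx s + 1 + k) true := fun k => by
    rw [simQ_apply, if_neg hnq, if_pos hs, htail, ← List.replicate_succ, List.replicate_append_replicate,
      show ancIdx s + (k + 1) = ancIdx s + 1 + k by omega]
  rw [probeAnswers, Ne, List.flatten_eq_nil_iff]
  simp only [List.mem_map, List.mem_range, forall_exists_index, and_imp,
    forall_apply_eq_imp_iff₂, hq, not_forall, exists_prop]
  constructor
  · rintro ⟨k, -, hk⟩
    have := (oracleOfFnAt_ne_nil_iff hj hf _).1 hk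
    rw [List.length_replicate] at this
    omega
  · intro hi
    refine ⟨j - (ancIdx s + 1), by omega, (oracleOfFnAt_ne_nil_iff hj hf _).2 ?_⟩
    rw [List.length_replicate]
    omega

end Answers

/-! ### Correctness of the simulator -/

/-- The level tag test under a parse: for a level string, `fstP s = 1ⁿ ↔ lvl s = n`. [folklore] -/
theorem fstP_eq_unary_iff {s : List Bool} (h : IsLevel s) (n : ℕ) : fstP s = unaryEncodeNat n ↔ lvl s = n := by
  rw [fstP_eq_of_isLevel h]
  constructor
  · intro he
    have := congrArg List.length he
    simpa [Complexity.unaryEncodeNat_eq_replicate] using this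
  · rintro rfl; rfl

/-- **Correctness of the evaluator.** On a genuine input `u = ⟨⟨1ⁿ, r⟩, s⟩` with the concatenated
answers of `oracleOfFnAt j f` to the `K ≥ max(1, j)` queries of `simQ`, the evaluator language holds
iff `s ∈ specLang E T n j f ∧ |s| ≤ q |z|`. [cite: AaronsonChen2017, Thm. 7.6 (proof, p. 30)] -/
theorem mem_simLang_answers_iff (q : Polynomial ℕ) (E : Finset ℕ) (T : Finset (List Bool)) {n j : ℕ}
    {f : List Bool → List Bool} (hj : 1 ≤ j) (hf : ∀ y : List Bool, y.length = j → (f y).length = j)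
    (r s : List Bool) {K : ℕ} (hK : j ≤ K) :
    boolPair (boolPair (boolPair (unaryEncodeNat n) r) s)
        (probeAnswers (oracleOfFnAt j f) (boolPair (boolPair (unaryEncodeNat n) r) s) K) ∈ simLang q E T ↔
      s ∈ specLang E T n j f ∧ s.length ≤ q.eval (boolPair (unaryEncodeNat n) r).length := by
  rw [mem_simLang_iff, mem_specLang_iff, mem_levelStrings_iff_parse]
  have hK1 : 1 ≤ K := hj.trans hK
  -- the level-`n` branch
  have hN : (fstP s = unaryEncodeNat n ∧
      ((IsAnc s ∧ probeAnswers (oracleOfFnAt j f) (boolPair (boolPair (unaryEncodeNat n) r) s) K ≠ []) ∨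
        (IsQry s ∧ probeAnswers (oracleOfFnAt j f) (boolPair (boolPair (unaryEncodeNat n) r) s) K ≠ [] ∧
          qryIdx s < (pt s).length ∧
            (probeAnswers (oracleOfFnAt j f) (boolPair (boolPair (unaryEncodeNat n) r) s) K).getD
              (qryIdx s) false = true))) ↔
      ((IsAnc s ∧ lvl s = n ∧ ancIdx s < j) ∨
        (IsQry s ∧ lvl s = n ∧ (pt s).length = j ∧ qryIdx s < j ∧ (f (pt s)).getD (qryIdx s) false = true)) := by
    constructor
    · rintro ⟨htag, (⟨ha, hne⟩ | ⟨hq, hne, hi, hb⟩)⟩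
      · exact Or.inl ⟨ha, (fstP_eq_unary_iff ha.1 n).1 htag, (answers_anc hj hf n r s ⟨ha, htag⟩ K hK).1 hne⟩
      · obtain ⟨h1, h2⟩ := answers_qry hj hf n r s ⟨hq, htag⟩ K hK1
        have hx : (pt s).length = j := h1.1 hne
        refine Or.inr ⟨hq, (fstP_eq_unary_iff hq.1 n).1 htag, hx, by omega, ?_⟩
        rwa [h2 hx _ (by omega)] at hb
    · rintro (⟨ha, hl, hi⟩ | ⟨hq, hl, hx, hi, hb⟩)
      · have htag := (fstP_eq_unary_iff ha.1 n).2 hl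
        exact ⟨htag, Or.inl ⟨ha, (answers_anc hj hf n r s ⟨ha, htag⟩ K hK).2 hi⟩⟩
      · have htag := (fstP_eq_unary_iff hq.1 n).2 hl
        obtain ⟨h1, h2⟩ := answers_qry hj hf n r s ⟨hq, htag⟩ K hK1
        refine ⟨htag, Or.inr ⟨hq, h1.2 hx, by omega, ?_⟩⟩
        rwa [h2 hx _ hi]
  -- the filler branch
  have hF : (lvl s ∉ E ∧ fstP s ≠ unaryEncodeNat n ∧
      ((IsAnc s ∧ ancIdx s < lvl s) ∨
        (IsQry s ∧ (pt s).length = lvl s ∧ qryIdx s < lvl s ∧ (pt s).getD (qryIdx s) false = true))) ↔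
      ∃ m, m ∉ E ∧ m ≠ n ∧ s ∈ levelStrings m m id := by
    constructor
    · rintro ⟨hE, htag, h⟩
      refine ⟨lvl s, hE, fun hl => htag ?_, (mem_levelStrings_iff_parse _ _ _ _).2 ?_⟩
      · rcases h with ⟨ha, -⟩ | ⟨hq, -⟩
        · exact (fstP_eq_unary_iff ha.1 n).2 hl
        · exact (fstP_eq_unary_iff hq.1 n).2 hl
      · rcases h with ⟨ha, hi⟩ | ⟨hq, hx, hi, hb⟩
        · exact Or.inl ⟨ha, rfl, hi⟩
        · exact Or.inr ⟨hq, rfl, hx, hi, hb⟩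
    · rintro ⟨m, hE, hmn, hmem⟩
      rcases (mem_levelStrings_iff_parse _ _ _ _).1 hmem with ⟨ha, hl, hi⟩ | ⟨hq, hl, hx, hi, hb⟩
      · subst hl
        exact ⟨hE, fun h => hmn ((fstP_eq_unary_iff ha.1 n).1 h), Or.inl ⟨ha, hi⟩⟩
      · subst hl
        exact ⟨hE, fun h => hmn ((fstP_eq_unary_iff hq.1 n).1 h), Or.inr ⟨hq, hx, hi, hb⟩⟩
  rw [hN, hF]
  constructor
  · rintro ⟨hlen, h⟩; exact ⟨h, hlen⟩
  · rintro ⟨h, hlen⟩; exact ⟨hlen, h⟩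

/-- **The simulator computes the intermediate oracle.** For `1 ≤ j ≤ B n`, a length-preserving
`f` on `{0,1}ʲ` and a genuine input `u = ⟨⟨1ⁿ, r⟩, s⟩`: within any budget of more than `B |u|`
rounds, `simN q B E T` with oracle `oracleOfFnAt j f` outputs `midOracle q E T n j f u`.
[cite: AaronsonChen2017, Thm. 7.6 (proof, p. 30)] [cite: LadnerLynchSelman1975, §3] -/
theorem run_simN (q B : Polynomial ℕ) (E : Finset ℕ) (T : Finset (List Bool)) {n j : ℕ}
    {f : List Bool → List Bool} (hj : 1 ≤ j) (hjB : j ≤ B.eval n)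
    (hf : ∀ y : List Bool, y.length = j → (f y).length = j) (r s : List Bool) {K : ℕ}
    (hK : B.eval (boolPair (boolPair (unaryEncodeNat n) r) s).length < K) :
    (simN q B E T).run (oracleOfFnAt j f) K (boolPair (boolPair (unaryEncodeNat n) r) s) =
      some (midOracle q E T n j f (boolPair (boolPair (unaryEncodeNat n) r) s)) := by
  unfold simN
  rw [run_ttFnAlg_oracle _ _ hK, midOracle_boolPair]
  congr 1
  unfold simG
  have hBK : j ≤ B.eval (boolPair (boolPair (unaryEncodeNat n) r) s).length := by
    refine hjB.trans (TM2Iter.eval_mono B ?_)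
    simp only [length_boolPair, Complexity.unaryEncodeNat_eq_replicate, List.length_replicate]
    omega
  have hiff := mem_simLang_answers_iff q E T hj hf r s hBK (n := n)
  rw [probeAnswers] at hiff
  change [(simLang q E T).boolIndicator _] = _
  congr 1
  by_cases h : s ∈ specLang E T n j f ∧ s.length ≤ q.eval (boolPair (unaryEncodeNat n) r).length
  · rw [(Set.mem_iff_boolIndicator _ _).1 (hiff.2 h),
      (Set.mem_iff_boolIndicator _ _).1 (show s ∈ ({s | s ∈ specLang E T n j f ∧
        s.length ≤ q.eval (boolPair (unaryEncodeNat n) r).length} : Language Bool) from h)]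
  · rw [(Set.notMem_iff_boolIndicator _ _).1 (fun h' => h (hiff.1 h')),
      (Set.notMem_iff_boolIndicator _ _).1 (show s ∉ ({s | s ∈ specLang E T n j f ∧
        s.length ≤ q.eval (boolPair (unaryEncodeNat n) r).length} : Language Bool) from h)]

/-- **The queries of the simulator are short**: every query on input `u` has length
`≤ |u| + B |u|`. [folklore] -/
theorem length_le_of_mem_queries_simN (q B : Polynomial ℕ) (E : Finset ℕ) (T : Finset (List Bool))
    (O : Oracle) (u : List Bool) {K : ℕ} {y : List Bool} (hy : y ∈ (simN q B E T).queries O K u) :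
    y.length ≤ u.length + B.eval u.length := by
  obtain ⟨k, hk, rfl⟩ := exists_of_mem_queries_ttFnAlg_oracle O u hy
  have := length_simQ_le u k
  omega

end ZhandrySim

end Literature.Computability.Cryptography
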